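import Summits.Ventures.CertifiedManyBodySolver.Downfold.ParameterBox
import Summits.Ventures.CertifiedManyBodySolver.Downfold.HubbardScaleTransport
import HarnessLib

/-!
# The one-band downfolded box in S2's frame (`U/t, tp/t, n, t_eV, …`) and box words from
# `t ≡ 1` cell words

Venture CertifiedManyBodySolver, cell `pub/hubbard-downfold` (stage S1 = downfolding front end),
seat hubbard-downfold-mod-1; namespace `Summit.Ventures.CertifiedManyBodySolver.Downfold`.
Everything here is PROVED. HONEST FRAMING: a downfolded box is a systematic modelling claim
(hypothesis `B.Mem p`); what transports is the certified word about the dimensionless family.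
Schema counterpart: `pub/hubbard-downfold/router/BOX-SCHEMA.md` v0 §1 (coordinate tokens) — the
constructors below are those tokens, in the order of record (ROUTER.md v0.2 §4.1: S2's frame first).

* `OneBandCoord` — `UOverT` (`U/t`), `tpOverT` (`tp/t`, cuprate-like `< 0`, DICTIONARY D0),
  `filling` (`n`, electrons per correlated site), `tEV` (`t_eV`, the scale), `tppOverT` (`tpp/t`),
  `tperpOverT` (`tperp/t`), `VOverT` (`V/t`), `WEV` (`W_eV`), `dsd` (self-doping charge), `JmeV`
  (`J_meV`, DERIVED only); `OneBandBox := Box OneBandCoord`. The lattice tag and `layers_per_cell`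
  are non-numeric trailer fields of the schema, not coordinates.
* `holdsOn_oneBand_of_cell` — THE S1/S2 SEAM: a word `W₁ s u n` about the `t ≡ 1` family
  `H(1, s, u)` at filling `n`, proved for every `(s, u, n)` of the product cell
  `e_tp.encl × e_U.encl × e_n.encl` of the box's `tp/t`, `U/t`, `n` entries, holds on the box as
  `p ↦ W₁ (p tpOverT) (p UOverT) (p filling)` (`Downfold.HoldsOn`). Ground-state expectations of the
  physical model `H(t, t·s, t·u) = t · H(1, s, u)` are those of `H(1, s, u)` (scale invariance), so
  correlator / stiffness-over-`t` words need nothing more; energies need the scale: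
* `holdsOn_energyDensityTT'_phys` — with the scale entry `e_t` (`0 ≤ e_t.encl.fst`), `U/t ≥ 0` and
  `n ⊂ [0, 2)` on the box and an enclosure `E ∋ e(1, s, u, n)` on the cell, the PHYSICAL energy
  density per site `e(t, t·s, t·u, n)` (in the unit of `t_eV`) lies in the Moore product
  `e_t.encl · E` for every `p ∈ B` (positive homogeneity `energyDensityTT'_smul`).

The build direction (Wannier `t, t', U` in eV ↦ shape intervals by `divPos`) is
`Downfold.HubbardScaleTransport` / `IntervalCalculus` §3; this file is the consumption direction.
-/

namespace Summit.Ventures.CertifiedManyBodySolver.Downfold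

open NonemptyInterval Literature.MathematicalPhysics.QuantumLattice
open Literature.MathematicalPhysics.QuantumLattice.ThermodynamicLimit

/-- **Coordinates of a one-band downfolded box in S2's frame** (BOX-SCHEMA v0 §1 tokens, ROUTER
v0.2 §4.1 order): `U/t`, `tp/t`, `n`, `t_eV`, `tpp/t`, `tperp/t`, `V/t`, `W_eV`, `dsd`, `J_meV`.
[folklore] -/
inductive OneBandCoord
  | UOverT
  | tpOverT
  | filling
  | tEV
  | tppOverT
  | tperpOverT
  | VOverT
  | WEV
  | dsd
  | JmeV
  deriving DecidableEq, Repr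

/-- A one-band downfolded parameter box (S2 frame). [folklore] -/
abbrev OneBandBox : Type := Box OneBandCoord

/-- **The S1/S2 seam.** Let the one-band box `B` carry entries `eS, eU, eN` for `tp/t`, `U/t`, `n`,
and let `W₁ s u n` be a word about the `t ≡ 1` family proved on the product cell
`eS.encl × eU.encl × eN.encl`. Then `p ↦ W₁ (p tpOverT) (p UOverT) (p filling)` holds on `B`.
(If S2 certifies `W₁` on a larger cell `C ⊇` that product, restrict first; if the product is not
inside any certified cell the honest word is «undetermined (box not covered)».) [folklore] -/
theorem holdsOn_oneBand_of_cell {B : OneBandBox} {eS eU eN : Entry}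
    (hS : B .tpOverT = some eS) (hU : B .UOverT = some eU) (hN : B .filling = some eN)
    {W₁ : ℝ → ℝ → ℝ → Prop}
    (hW : ∀ s u n : ℝ, s ∈ eS.encl.ratCast ℝ → u ∈ eU.encl.ratCast ℝ → n ∈ eN.encl.ratCast ℝ →
      W₁ s u n) :
    HoldsOn (fun p : OneBandCoord → ℝ => W₁ (p .tpOverT) (p .UOverT) (p .filling)) B :=
  fun _ hp => hW _ _ _ (hp _ _ hS) (hp _ _ hU) (hp _ _ hN)

/-- A two-coordinate variant of the seam (words that do not depend on the filling entry, or whose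
filling is fixed inside `W₁`): entries for `tp/t` and `U/t` suffice. [folklore] -/
theorem holdsOn_oneBand_of_cell₂ {B : OneBandBox} {eS eU : Entry}
    (hS : B .tpOverT = some eS) (hU : B .UOverT = some eU) {W₁ : ℝ → ℝ → Prop}
    (hW : ∀ s u : ℝ, s ∈ eS.encl.ratCast ℝ → u ∈ eU.encl.ratCast ℝ → W₁ s u) :
    HoldsOn (fun p : OneBandCoord → ℝ => W₁ (p .tpOverT) (p .UOverT)) B :=
  fun _ hp => hW _ _ (hp _ _ hS) (hp _ _ hU)

/-- **Physical energy density on a one-band box (shape × scale).** Let `B` carry entries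
`eT, eS, eU, eN` for `t_eV`, `tp/t`, `U/t`, `n` with `0 ≤ eT.encl.fst` (nonnegative scale),
`0 ≤ eU.encl.fst` and `eN.encl ⊂ [0, 2)`, and let `E` enclose the unit energy density
`e(1, s, u, n)` for all `(s, u, n)` in the cell `eS.encl × eU.encl × eN.encl` (`u ≥ 0`). Then for
every `p ∈ B` the energy density of the physical model `H(t, t·s, t·u)` at filling `n`,
`e(p t, p t · p s, p t · p u, p n)`, lies in `eT.encl · E` (Moore product; unit = the unit of `t_eV`).
[folklore] -/
theorem holdsOn_energyDensityTT'_phys {B : OneBandBox} {eT eS eU eN : Entry}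
    {E : NonemptyInterval ℚ} (hT : B .tEV = some eT) (hS : B .tpOverT = some eS)
    (hU : B .UOverT = some eU) (hN : B .filling = some eN) (hT0 : 0 ≤ eT.encl.fst)
    (hU0 : 0 ≤ eU.encl.fst) (hn0 : 0 ≤ eN.encl.fst) (hn2 : eN.encl.snd < 2)
    (hE : ∀ s u n : ℝ, s ∈ eS.encl.ratCast ℝ → u ∈ eU.encl.ratCast ℝ → 0 ≤ u →
      n ∈ eN.encl.ratCast ℝ → energyDensityTT' 1 s u n ∈ E.ratCast ℝ) :
    HoldsOn (fun p : OneBandCoord → ℝ =>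
      energyDensityTT' (p .tEV) (p .tEV * p .tpOverT) (p .tEV * p .UOverT) (p .filling) ∈
        (eT.encl.mooreMul E).ratCast ℝ) B := by
  intro p hp
  have ht : p .tEV ∈ eT.encl.ratCast ℝ := hp _ _ hT
  have hu : p .UOverT ∈ eU.encl.ratCast ℝ := hp _ _ hU
  have hn : p .filling ∈ eN.encl.ratCast ℝ := hp _ _ hN
  have ht0 : (0 : ℝ) ≤ p .tEV := le_trans (by exact_mod_cast hT0) (mem_ratCast_iff.1 ht).1
  have hu0 : (0 : ℝ) ≤ p .UOverT := le_trans (by exact_mod_cast hU0) (mem_ratCast_iff.1 hu).1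
  have hn0' : (0 : ℝ) ≤ p .filling := le_trans (by exact_mod_cast hn0) (mem_ratCast_iff.1 hn).1
  have hn2' : p .filling < 2 := lt_of_le_of_lt (mem_ratCast_iff.1 hn).2 (by exact_mod_cast hn2)
  have hsmul := energyDensityTT'_smul 1 (p .tpOverT) hu0 hn0' hn2' ht0
  rw [mul_one] at hsmul
  rw [hsmul, ratCast_mooreMul]
  exact mul_mem_mooreMul ht (hE _ _ _ (hp _ _ hS) hu hu0 hn)

/-- **One-sided version (certified LOWER bound, e.g. an SDP row)**: `L ≤ e(1, s, u, n)` on the cell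
gives `min (eT.lo · L) (eT.hi · L) ≤ e(t, t·s, t·u, n)` on the box. [folklore] -/
theorem holdsOn_energyDensityTT'_phys_ge {B : OneBandBox} {eT eS eU eN : Entry} {L : ℚ}
    (hT : B .tEV = some eT) (hS : B .tpOverT = some eS) (hU : B .UOverT = some eU)
    (hN : B .filling = some eN) (hT0 : 0 ≤ eT.encl.fst) (hU0 : 0 ≤ eU.encl.fst)
    (hn0 : 0 ≤ eN.encl.fst) (hn2 : eN.encl.snd < 2)
    (hL : ∀ s u n : ℝ, s ∈ eS.encl.ratCast ℝ → u ∈ eU.encl.ratCast ℝ → 0 ≤ u →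
      n ∈ eN.encl.ratCast ℝ → (L : ℝ) ≤ energyDensityTT' 1 s u n) :
    HoldsOn (fun p : OneBandCoord → ℝ =>
      ((min (eT.encl.fst * L) (eT.encl.snd * L) : ℚ) : ℝ) ≤
        energyDensityTT' (p .tEV) (p .tEV * p .tpOverT) (p .tEV * p .UOverT) (p .filling)) B := by
  intro p hp
  have ht := mem_ratCast_iff.1 (hp _ _ hT)
  have hu : p .UOverT ∈ eU.encl.ratCast ℝ := hp _ _ hU
  have hn : p .filling ∈ eN.encl.ratCast ℝ := hp _ _ hN
  have ht0 : (0 : ℝ) ≤ p .tEV := le_trans (by exact_mod_cast hT0) ht.1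
  have hu0 : (0 : ℝ) ≤ p .UOverT := le_trans (by exact_mod_cast hU0) (mem_ratCast_iff.1 hu).1
  have hn0' : (0 : ℝ) ≤ p .filling := le_trans (by exact_mod_cast hn0) (mem_ratCast_iff.1 hn).1
  have hn2' : p .filling < 2 := lt_of_le_of_lt (mem_ratCast_iff.1 hn).2 (by exact_mod_cast hn2)
  have hsmul := energyDensityTT'_smul 1 (p .tpOverT) hu0 hn0' hn2' ht0
  rw [mul_one] at hsmul
  have he : (L : ℝ) ≤ energyDensityTT' 1 (p .tpOverT) (p .UOverT) (p .filling) :=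
    hL _ _ _ (hp _ _ hS) hu hu0 hn
  have h1 : p .tEV * (L : ℝ) ≤ p .tEV * energyDensityTT' 1 (p .tpOverT) (p .UOverT) (p .filling) :=
    mul_le_mul_of_nonneg_left he ht0
  rw [hsmul]
  push_cast
  refine le_trans ?_ h1
  rcases le_total 0 (L : ℝ) with hL0 | hL0
  · exact (min_le_left _ _).trans (mul_le_mul_of_nonneg_right ht.1 hL0)
  · exact (min_le_right _ _).trans (mul_le_mul_of_nonpos_right ht.2 hL0)

/-- **One-sided version (certified UPPER bound, e.g. a variational row)**: `e(1, s, u, n) ≤ R` on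
the cell gives `e(t, t·s, t·u, n) ≤ max (eT.lo · R) (eT.hi · R)` on the box. [folklore] -/
theorem holdsOn_energyDensityTT'_phys_le {B : OneBandBox} {eT eS eU eN : Entry} {R : ℚ}
    (hT : B .tEV = some eT) (hS : B .tpOverT = some eS) (hU : B .UOverT = some eU)
    (hN : B .filling = some eN) (hT0 : 0 ≤ eT.encl.fst) (hU0 : 0 ≤ eU.encl.fst)
    (hn0 : 0 ≤ eN.encl.fst) (hn2 : eN.encl.snd < 2)
    (hR : ∀ s u n : ℝ, s ∈ eS.encl.ratCast ℝ → u ∈ eU.encl.ratCast ℝ → 0 ≤ u →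
      n ∈ eN.encl.ratCast ℝ → energyDensityTT' 1 s u n ≤ (R : ℝ)) :
    HoldsOn (fun p : OneBandCoord → ℝ =>
      energyDensityTT' (p .tEV) (p .tEV * p .tpOverT) (p .tEV * p .UOverT) (p .filling) ≤
        ((max (eT.encl.fst * R) (eT.encl.snd * R) : ℚ) : ℝ)) B := by
  intro p hp
  have ht := mem_ratCast_iff.1 (hp _ _ hT)
  have hu : p .UOverT ∈ eU.encl.ratCast ℝ := hp _ _ hU
  have hn : p .filling ∈ eN.encl.ratCast ℝ := hp _ _ hN
  have ht0 : (0 : ℝ) ≤ p .tEV := le_trans (by exact_mod_cast hT0) ht.1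
  have hu0 : (0 : ℝ) ≤ p .UOverT := le_trans (by exact_mod_cast hU0) (mem_ratCast_iff.1 hu).1
  have hn0' : (0 : ℝ) ≤ p .filling := le_trans (by exact_mod_cast hn0) (mem_ratCast_iff.1 hn).1
  have hn2' : p .filling < 2 := lt_of_le_of_lt (mem_ratCast_iff.1 hn).2 (by exact_mod_cast hn2)
  have hsmul := energyDensityTT'_smul 1 (p .tpOverT) hu0 hn0' hn2' ht0
  rw [mul_one] at hsmul
  have he : energyDensityTT' 1 (p .tpOverT) (p .UOverT) (p .filling) ≤ (R : ℝ) :=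
    hR _ _ _ (hp _ _ hS) hu hu0 hn
  have h1 : p .tEV * energyDensityTT' 1 (p .tpOverT) (p .UOverT) (p .filling) ≤ p .tEV * (R : ℝ) :=
    mul_le_mul_of_nonneg_left he ht0
  rw [hsmul]
  push_cast
  refine le_trans h1 ?_
  rcases le_total 0 (R : ℝ) with hR0 | hR0
  · exact (mul_le_mul_of_nonneg_right ht.2 hR0).trans (le_max_right _ _)
  · exact (mul_le_mul_of_nonpos_right ht.1 hR0).trans (le_max_left _ _)

end Summit.Ventures.CertifiedManyBodySolver.Downfold
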